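import Mathlib.Analysis.Calculus.Rademacher
import Literature.Analysis.FunctionSpaces.SobolevDomain
import HarnessLib

/-!
# AxisTwistDoorAveragedConeLiouvilleNUWeakDerivLip — a Lipschitz function has its a.e. derivative as
# weak derivative (tool (t1′) of the N4/T1 Lipschitz ports)

For `u : ℝ³ → ℝ` `K`-Lipschitz and any open `Ω`, `HasWeakFDerivOn Ω volume u (fderiv ℝ u)`
(Rademacher: `fderiv ℝ u` exists a.e. and is bounded by `K`; integration by parts against test
functions is Mathlib's `LipschitzWith.integral_lineDeriv_mul_eq`).  With it the tree's weak-derivative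
Sobolev inequalities and parabolic embeddings (`eLpNorm_le_eLpNorm_weakFDeriv_of_eq`,
`ae_sobolev_six_slice_bound_of_hasWeakFDerivOn`, `parabolicEmbedding_of_hasWeakFDerivOn`) apply to
Lipschitz slices verbatim, without compact support.  An INPUT tool; no NS-regularity statement is
touched. [folklore]
-/

set_option linter.dupNamespace false

noncomputable section

open MeasureTheory Set Function Filter Topology Metric
open scoped NNReal ENNReal

namespace Summit.NavierStokesRegularity.NavierStokesRegularity.Theorems.AveragedConeLiouville.NU

open Literature.Analysis.FunctionSpaces

/-- The a.e. derivative of a Lipschitz function on a finite-dimensional space is locally integrable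
(measurable by `measurable_fderiv`, bounded by the Lipschitz constant). [folklore] -/
theorem locallyIntegrable_fderiv_of_lipschitz {E : Type*} [NormedAddCommGroup E] [NormedSpace ℝ E]
    [FiniteDimensional ℝ E] [MeasurableSpace E] [BorelSpace E] {μ : Measure E}
    [IsLocallyFiniteMeasure μ] {u : E → ℝ} {K : ℝ≥0} (hu : LipschitzWith K u) :
    LocallyIntegrable (fderiv ℝ u) μ := by
  intro x
  obtain ⟨U, hU, hUf⟩ := μ.exists_isOpen_measure_lt_top x
  refine ⟨U, hUf.1.mem_nhds hU, ?_⟩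
  exact Measure.integrableOn_of_bounded hUf.2.ne (measurable_fderiv ℝ u).aestronglyMeasurable
    (ae_of_all _ fun z => norm_fderiv_le_of_lipschitz ℝ hu)

/-- **A Lipschitz function has its a.e. derivative as weak derivative** on every open set of a
finite-dimensional space with an additive Haar measure: `HasWeakFDerivOn Ω μ u (fderiv ℝ u)`.
[folklore] -/
theorem hasWeakFDerivOn_of_lipschitz' {E : Type*} [NormedAddCommGroup E] [NormedSpace ℝ E]
    [FiniteDimensional ℝ E] [MeasurableSpace E] [BorelSpace E] {μ : Measure E} [μ.IsAddHaarMeasure]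
    {u : E → ℝ} {K : ℝ≥0} (hu : LipschitzWith K u) (Ω : TopologicalSpace.Opens E) :
    HasWeakFDerivOn Ω μ u (fderiv ℝ u) where
  locallyIntegrableOn := hu.continuous.locallyIntegrable.locallyIntegrableOn _
  locallyIntegrableOn_deriv := (locallyIntegrable_fderiv_of_lipschitz hu).locallyIntegrableOn _
  integral_fderiv_smul_eq := by
    intro φ v hφ
    have hφ1 : ContDiff ℝ 1 φ := hφ.contDiff.of_le (by norm_cast)
    -- off `Ω` both integrands vanish
    have hφ0 : ∀ x, x ∉ (Ω : Set E) → φ x = 0 := fun x hx =>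
      image_eq_zero_of_notMem_tsupport fun h => hx (hφ.tsupport_subset h)
    have hDφ0 : ∀ x, x ∉ (Ω : Set E) → fderiv ℝ φ x = 0 := fun x hx => by
      by_contra h
      exact hx (hφ.tsupport_subset (support_fderiv_subset ℝ (Function.mem_support.2 h)))
    rw [setIntegral_eq_integral_of_forall_compl_eq_zero (fun x hx => by rw [hDφ0 x hx]; simp),
      setIntegral_eq_integral_of_forall_compl_eq_zero (fun x hx => by rw [hφ0 x hx]; simp)]
    simp only [smul_eq_mul]
    -- integration by parts for Lipschitz functions (Mathlib)
    obtain ⟨D, hD⟩ := hφ1.lipschitzWith_of_hasCompactSupport hφ.hasCompactSupport one_ne_zero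
    have key := hu.integral_lineDeriv_mul_eq (μ := μ) hD hφ.hasCompactSupport v
    have hφd : ∀ x, lineDeriv ℝ φ x (-v) = -fderiv ℝ φ x v := fun x => by
      rw [((hφ1.differentiable one_ne_zero) x).lineDeriv_eq_fderiv, map_neg]
    have hud : (fun x => lineDeriv ℝ u x v * φ x) =ᵐ[μ] fun x => fderiv ℝ u x v * φ x := by
      filter_upwards [hu.ae_differentiableAt (μ := μ)] with x hx
      rw [hx.lineDeriv_eq_fderiv]
    rw [integral_congr_ae hud] at key
    simp only [hφd, neg_mul, integral_neg] at key
    calc ∫ x, fderiv ℝ φ x v * u x ∂μ = -∫ x, fderiv ℝ u x v * φ x ∂μ := by rw [key, neg_neg]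
      _ = -∫ x, φ x * fderiv ℝ u x v ∂μ := by simp_rw [mul_comm]

/-- **A Lipschitz function on `ℝ³` has its a.e. derivative as weak derivative** (Lebesgue measure,
any open `Ω`) — the form the N–U Lipschitz ports consume. [folklore] -/
theorem hasWeakFDerivOn_of_lipschitz {u : EuclideanSpace ℝ (Fin 3) → ℝ} {K : ℝ≥0}
    (hu : LipschitzWith K u) (Ω : TopologicalSpace.Opens (EuclideanSpace ℝ (Fin 3))) :
    HasWeakFDerivOn Ω volume u (fderiv ℝ u) :=
  hasWeakFDerivOn_of_lipschitz' hu Ω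

end Summit.NavierStokesRegularity.NavierStokesRegularity.Theorems.AveragedConeLiouville.NU
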